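import Summits.CriticalPhenomena.PercolationContinuityZ3.Theorems.PercNearOneGluingNoHeavyLowerTailThreePointVarianceGladkovRegime
import Mathlib.Tactic.Linarith
import Mathlib.Tactic.Ring
import HarnessLib

/-!
# The three-point variance row `(3PT)` in the Gladkov–Zimin regime — every finite weighted graph

Support file for crux `stmt-CriticalPhenomena-4575` (`NoHeavyLowerTail`), seat `prim-l12-p1` gen 18
(`--supports stmt-CriticalPhenomena-4575`).  Memo `run/shared/lean/prim/prim-l12/FROM-prim-l12-p1-g18-*.md`.

Bond percolation `μ = prodBernoulli w` (arbitrary pair weights, finite vertex type `V`), vertices `a b c`, cells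
`x = μ(abc)`, `s = μ(ab|c)`, `t = μ(ac|b)`, `u = μ(a|bc)`, `q = μ(a|b|c)`; `θ = μ(a↔b) = x + s`,
`γ = μ(c ↔ {a,b}) = μ(ac ∪ bc) = x + t + u`.  The row under study (conjectured ∀n; proved ∀n so far only on the
classes of `…ThreePointVarianceTwoNeighbours/CutVertex/BehindCutVertex/Isolation/GladkovRegime(Sum)`) is

  `(3PT)   θ(1 − θ) ≤ s + t + u`,   i.e.   `Var(1_{a↔b}) ≤ μ(exactly two clusters among a, b, c)`.

Gladkov–Zimin's Theorem 4.6 (tree: `gladkovZimin2024_threePoint_prodBernoulli`, apex form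
`μ(a|b ∩ a|c)·μ(ab ∪ ac) ≤ μ(ab|c) + μ(ac|b) + μ(a|bc)` [cite: GladkovZimin2024, Thm. 4.6]), read with apex `c`,
is the DUAL row `γ(1 − γ) ≤ s + t + u`, i.e. `Var(1_{c↔{a,b}}) ≤ μ(exactly two clusters)`: both rows say that
the indicators `1_{a↔b}` and `1_{c↔{a,b}}` are at `L²`-distance (`= μ(exactly two clusters)`) at least the
standard deviation of one of them.  Since `θ(1−θ) − γ(1−γ) = (θ − γ)(1 − θ − γ) = (s − t − u)(q − x)`,
THIS FILE records the free corollary: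

* `threePointVariance_of_gz_regime`: if `(s − t − u)·(q − x) ≤ 0` then `(3PT)` — on every finite weighted graph.

So `(3PT)` is OPEN only where `μ(a↔b)` is strictly closer to `1/2` than `μ(c↔{a,b})` is, i.e. in the two
regions `{s > t+u, q > x}` (sparse side) and `{s < t+u, q < x}` (dense side); the latter contains the hub
families `H_k` that carry the sharp transport constant `1/2` of `(3PT)` and the exact counterexamples to the
gen-17 regime conjecture CONJ-R (memo gen 18: `H_k` with `k = 45 000`, outside `R_t ∪ R_u ∪ R_sum`).

Main results: `gz_regime_algebra`, `threePointVariance_of_gz_regime`.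
-/

namespace Summit.CriticalPhenomena.PercolationContinuityZ3.Theorems.ThreePointVarianceGZRegime

open MeasureTheory Set
open Literature.Probability.Percolation Literature.Probability.LatticeModels
open Summit.CriticalPhenomena.PercolationContinuityZ3.Theorems.ThreePointVarianceGladkovRegime (cells_eq)

/-- **The algebra of the GZ-regime corollary.**  With `θ = x + s`, `γ = x + t + u`, `x + s + t + u + q = 1`:
`θ(1−θ) = γ(1−γ) + (s − t − u)(q − x)`, so GZ24 Thm 4.6 at `c` (`γ(1−γ) ≤ s+t+u`) and `(s−t−u)(q−x) ≤ 0`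
give `θ(1−θ) ≤ s + t + u`. [this work] -/
theorem gz_regime_algebra {x s t u q : ℝ} (hsum : x + s + t + u + q = 1)
    (hGZ : (x + t + u) * (1 - (x + t + u)) ≤ s + t + u)
    (hH : (s - t - u) * (q - x) ≤ 0) :
    (x + s) * (1 - (x + s)) ≤ s + t + u := by
  have key : (x + s) * (1 - (x + s)) = (x + t + u) * (1 - (x + t + u)) + (s - t - u) * (q - x) := by
    have hq : q = 1 - x - s - t - u := by linarith
    rw [hq]; ring
  rw [key]; linarith

variable {V : Type*} [Fintype V]

/-- **`(3PT)` in the Gladkov–Zimin regime, on every finite weighted graph.**  For `μ = prodBernoulli w` and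
vertices `a b c`, write `x = μ(a↔b, a↔c)`, `s = μ(ab|c) = μ(a↔b, a↮c)`, `t = μ(ac|b) = μ(a↔c, a↮b)`,
`u = μ(a|bc) = μ(b↔c, a↮b)`, `q = μ(a|b|c)`.  If `(s − t − u)·(q − x) ≤ 0` — equivalently
`|μ(a↔b) − 1/2| ≥ |μ(c↔{a,b}) − 1/2|` — then `μ(a↔b)·μ(a↮b) ≤ s + t + u`.
Corollary of [cite: GladkovZimin2024, Thm. 4.6] read with apex `c`; the regime statement is [this work]. -/
theorem threePointVariance_of_gz_regime (w : Sym2 V → unitInterval) (a b c : V)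
    (hH : ((prodBernoulli w).real (openConn a b ∩ (openConn a c)ᶜ) -
            (prodBernoulli w).real (openConn a c ∩ (openConn a b)ᶜ) -
            (prodBernoulli w).real (openConn b c ∩ (openConn a b)ᶜ)) *
          ((prodBernoulli w).real ((openConn a b)ᶜ ∩ (openConn a c)ᶜ ∩ (openConn b c)ᶜ) -
            (prodBernoulli w).real (openConn a b ∩ openConn a c)) ≤ 0) :
    (prodBernoulli w).real (openConn a b) * (prodBernoulli w).real (openConn a b)ᶜ ≤
      (prodBernoulli w).real (openConn a b ∩ (openConn a c)ᶜ) + (prodBernoulli w).real (openConn a c ∩ (openConn a b)ᶜ) +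
        (prodBernoulli w).real (openConn b c ∩ (openConn a b)ᶜ) := by
  classical
  obtain ⟨_, _, cA, u₃, u₂, u₁, _, _, cBC, cQ⟩ := cells_eq w a b c
  -- GZ24 Thm 4.6 with apex `c`: instantiate at the triple `(c, a, b)` and translate the events
  have hGZ := gladkovZimin2024_threePoint_prodBernoulli w c a b
  have eca : (openConn c a : Set (BondConfig V)) = openConn a c := by
    ext ω
    exact ⟨fun h' => SimpleGraph.Reachable.symm h', fun h' => SimpleGraph.Reachable.symm h'⟩
  have ecb : (openConn c b : Set (BondConfig V)) = openConn b c := by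
    ext ω
    exact ⟨fun h' => SimpleGraph.Reachable.symm h', fun h' => SimpleGraph.Reachable.symm h'⟩
  -- `{c↔a} ∩ {c↔b}ᶜ = {a↔c} ∩ {a↔b}ᶜ`
  have e1 : (openConn c a ∩ (openConn c b)ᶜ : Set (BondConfig V)) = openConn a c ∩ (openConn a b)ᶜ := by
    ext ω
    simp only [Set.mem_inter_iff, Set.mem_compl_iff]
    constructor
    · rintro ⟨hca, hcb⟩
      exact ⟨SimpleGraph.Reachable.symm hca, fun hab => hcb (SimpleGraph.Reachable.trans hca hab)⟩
    · rintro ⟨hac, hab⟩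
      exact ⟨SimpleGraph.Reachable.symm hac,
        fun hcb => hab (SimpleGraph.Reachable.trans hac hcb)⟩
  -- `{c↔b} ∩ {c↔a}ᶜ = {b↔c} ∩ {a↔b}ᶜ`
  have e2 : (openConn c b ∩ (openConn c a)ᶜ : Set (BondConfig V)) = openConn b c ∩ (openConn a b)ᶜ := by
    ext ω
    simp only [Set.mem_inter_iff, Set.mem_compl_iff]
    constructor
    · rintro ⟨hcb, hca⟩
      exact ⟨SimpleGraph.Reachable.symm hcb, fun hab => hca (SimpleGraph.Reachable.trans hcb (SimpleGraph.Reachable.symm hab))⟩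
    · rintro ⟨hbc, hab⟩
      exact ⟨SimpleGraph.Reachable.symm hbc,
        fun hca => hab (SimpleGraph.Reachable.trans (SimpleGraph.Reachable.symm hca) (SimpleGraph.Reachable.symm hbc))⟩
  -- `{c↔a}ᶜ ∩ {c↔b}ᶜ ∩ {a↔b} = {a↔b} ∩ {a↔c}ᶜ`
  have e3 : ((openConn c a)ᶜ ∩ (openConn c b)ᶜ ∩ openConn a b : Set (BondConfig V)) =
      openConn a b ∩ (openConn a c)ᶜ := by
    ext ω
    simp only [Set.mem_inter_iff, Set.mem_compl_iff]
    constructor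
    · rintro ⟨⟨hca, _⟩, hab⟩
      exact ⟨hab, fun hac => hca (SimpleGraph.Reachable.symm hac)⟩
    · rintro ⟨hab, hac⟩
      exact ⟨⟨fun hca => hac (SimpleGraph.Reachable.symm hca),
        fun hcb => hac (SimpleGraph.Reachable.trans hab (SimpleGraph.Reachable.symm hcb))⟩, hab⟩
  -- `{c↔a}ᶜ ∩ {c↔b}ᶜ = {a↔c}ᶜ ∩ {b↔c}ᶜ`, `{c↔a} ∪ {c↔b} = {a↔c} ∪ {b↔c}`
  have e4 : ((openConn c a)ᶜ ∩ (openConn c b)ᶜ : Set (BondConfig V)) = (openConn a c)ᶜ ∩ (openConn b c)ᶜ := by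
    rw [eca, ecb]
  have e5 : (openConn c a ∪ openConn c b : Set (BondConfig V)) = openConn a c ∪ openConn b c := by
    rw [eca, ecb]
  rw [e1, e2, e3, e4, e5] at hGZ
  -- the union `{a↔c} ∪ {b↔c}` in terms of the basic masses
  have mEac : MeasurableSet (openConn a c : Set (BondConfig V)) := MeasurableSet.of_discrete
  have mEbc : MeasurableSet (openConn b c : Set (BondConfig V)) := MeasurableSet.of_discrete
  have hTI : (openConn a c ∩ openConn b c : Set (BondConfig V)) = openConn a b ∩ openConn a c := by
    ext ω
    constructor
    · rintro ⟨hac, hbc⟩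
      exact ⟨SimpleGraph.Reachable.trans hac (SimpleGraph.Reachable.symm hbc), hac⟩
    · rintro ⟨hab, hac⟩
      exact ⟨hac, SimpleGraph.Reachable.trans (SimpleGraph.Reachable.symm hab) hac⟩
  have hU : (prodBernoulli w).real (openConn a c ∪ openConn b c) =
      (prodBernoulli w).real (openConn a c) + (prodBernoulli w).real (openConn b c) -
        (prodBernoulli w).real (openConn a b ∩ openConn a c) := by
    have h := measureReal_union_add_inter (μ := prodBernoulli w) (s := openConn a c) mEbc
    rw [hTI] at h
    linarith
  rw [cBC, hU] at hGZ
  rw [u₃, u₂, u₁, cQ] at hH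
  rw [cA, u₃, u₂, u₁]
  -- abbreviate the four basic masses and conclude by the algebra
  set X := (prodBernoulli w).real (openConn a b) with hX
  set Y := (prodBernoulli w).real (openConn a c) with hY
  set Z := (prodBernoulli w).real (openConn b c) with hZ
  set TT := (prodBernoulli w).real (openConn a b ∩ openConn a c) with hTT
  have key := gz_regime_algebra (x := TT) (s := X - TT) (t := Y - TT) (u := Z - TT)
    (q := 1 - X - Y - Z + 2 * TT) (by ring) (by
      have e : TT + (Y - TT) + (Z - TT) = Y + Z - TT := by ring
      rw [e]; linarith [hGZ]) (by linarith [hH])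
  have e' : TT + (X - TT) = X := by ring
  rw [e'] at key
  linarith [key]

end Summit.CriticalPhenomena.PercolationContinuityZ3.Theorems.ThreePointVarianceGZRegime
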